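import Summits.ResolutionOfSingularities.ResolutionOfSingularities.Theorems.OddCrossCutClasses
import HarnessLib

/-!
# OddCrossCutCells — decomp-res node «OddCrossCut» (lens-2 g23)

Content VERBATIM from the decomp-res lens-2 g23 node `HOME/decomp-res-lens-2/g23/OddCrossCut.lean` (pin aae59dc8, 6
388 l; HOME = run/shared/lean/pub/decomp-res); CRITIC-LEDGER row 184 CLEARED ((X***) `OddCrossExit`
DECIDED-MOD-PORT(M+) +1 · MAP 0: residue-characteristic ≠ 2 deep crosses typed as a CLASS WITH TAILS + the odd
guard; exit package decided on paper to cn27 standard by ODD DOMINATION; exact re-location of `IsDeepSpecialPt`);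
landing orders NEXT-g24 §Landing + critic rider INBOX :970: ONLY the NEW part §Z (node lines 5511–6388) is landed —
the node's CARRIED copies of g14–g22 (lines 306–4942, 4991–5507; ns `…Theses.OddCrossCut`) are NOT landed
(DELETE-on-landing: they ARE the tree modules
PinchCut/JetCut/PurityCut/SplitCut/CylinderCut/SpreadCut/CrossCut/DeepCrossCut*, opened here instead); namespace
`…Theses.OddCrossCut` ↦ `…Theorems.OddCrossCut`; all files `--kind proof --supports
stmt-ResolutionOfSingularities-29273` (the ring-kernel file as helper).  Farm (node, critic re-farm): rc 0 · 0 err ·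
0 warn · 0 sorry · axioms std.

§Z.4–§Z.7 minus the wiring (NEW): the ODD leaf `oddLeaf = deepLeaf ∨ (X***)` + order lemmas, the located residual
class **`IsOddSpecialPt`** (deep-special ∧ ¬ odd-cross) with `isSpecPt_oddLeaf_iff` / `isDeepSpecialPt_iff` /
`isOddSpecialPt_iff_*`; `namespace OddX`: graded statements `SeqOddGen` / `SeqOddSpec`, rungs `OddGenRungAt` /
**`OddGenericRung`** / **`OddSpecialRung`** (THE LOCATED RESIDUAL of the lens-2 column after g23; cone-free home),
`section Kernels` (instantiated from §G; 0 sorry) — everything of §Z.5–§Z.7 that does not name the host route.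

(Sources: Hironaka1964 Ch. III; CossartJannsenSaito2020 Ch. 2, Ch. 8–9; CossartPiltant2008 Prop. 4.2;
CossartPiltant2019 Rem. 3.2; BierstoneGrigorievMilmanWlodarczyk2011 §3.1; Moh1987; Hauser2010Kangaroo; Giraud1975;
Narasimhan1983.)
-/

open CategoryTheory AlgebraicGeometry TopologicalSpace IsLocalRing
open Literature.AlgebraicGeometry.Resolution
open Summit.ResolutionOfSingularities.ResolutionOfSingularities.Theorems
open Summit.ResolutionOfSingularities.ResolutionOfSingularities.Theorems.WeakOrderReduction
open Summit.ResolutionOfSingularities.ResolutionOfSingularities.Theorems.DeltaFaceCutClasses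
open Summit.ResolutionOfSingularities.ResolutionOfSingularities.Theorems.RelativeDeltaCut
open Summit.ResolutionOfSingularities.ResolutionOfSingularities.Theorems.CurveLeafExit
open Summit.ResolutionOfSingularities.ResolutionOfSingularities.Theorems.DeepCrossCut
open Summit.ResolutionOfSingularities.ResolutionOfSingularities.Theorems.PinchCut
open Summit.ResolutionOfSingularities.ResolutionOfSingularities.Theorems.JetCut
open Summit.ResolutionOfSingularities.ResolutionOfSingularities.Theorems.PurityCut
open Summit.ResolutionOfSingularities.ResolutionOfSingularities.Theorems.SplitCut
open Summit.ResolutionOfSingularities.ResolutionOfSingularities.Theorems.CylinderCut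
open Summit.ResolutionOfSingularities.ResolutionOfSingularities.Theorems.SpreadCut
open Summit.ResolutionOfSingularities.ResolutionOfSingularities.Theorems.CrossCut
open Summit.ResolutionOfSingularities.ResolutionOfSingularities.Theorems.DeepCrossCut
open MvPolynomial

namespace Summit.ResolutionOfSingularities.ResolutionOfSingularities.Theorems.OddCrossCut

/-! ## §Z.4  NEW (g23): the ODD cut — the leaf `oddLeaf = deepLeaf ∨ (X***)`, its located residual class
`IsOddSpecialPt`, the rungs
(instances of §G over g20's COMPONENT port), `OddX.closes` BY NAME, the engines at work, and the EXACT RE-LOCATION of g22's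
`Deep.DeepSpecialRung` (and of every earlier residual of the lineage and of the tree aside
`MaxContactCut.LeafSpecialRung`) modulo the odd
decided half — all 0 sorry. -/

/-- The ODD leaf of g23: deep leaf (g21/g22) ∨ odd-cross point.  DEFINITION (leaf instance). [folklore] -/
def oddLeaf : ∀ ⦃Y : Scheme.{0}⦄, Y.IdealSheafData → ℕ → Y → Prop :=
  fun _ I n y => deepLeaf I n y ∨ IsOddCrossPt I n y

/-- `deepLeaf_le_oddLeaf`: Auxiliary step of this node's calculus, VERBATIM from the lens file (see the module
docstring); the statement is its type. [folklore] -/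
theorem deepLeaf_le_oddLeaf ⦃Y : Scheme.{0}⦄ (I : Y.IdealSheafData) (n : ℕ) (y : Y) :
    deepLeaf I n y → oddLeaf I n y :=
  fun h => Or.inl h

/-- `crossLeaf_le_oddLeaf`: Auxiliary step of this node's calculus, VERBATIM from the lens file (see the module
docstring); the statement is its type. [folklore] -/
theorem crossLeaf_le_oddLeaf ⦃Y : Scheme.{0}⦄ (I : Y.IdealSheafData) (n : ℕ) (y : Y) :
    crossLeaf I n y → oddLeaf I n y :=
  fun h => Or.inl (crossLeaf_le_deepLeaf I n y h)

/-- `spreadLeaf_le_oddLeaf`: Auxiliary step of this node's calculus, VERBATIM from the lens file (see the module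
docstring); the statement is its type. [folklore] -/
theorem spreadLeaf_le_oddLeaf ⦃Y : Scheme.{0}⦄ (I : Y.IdealSheafData) (n : ℕ) (y : Y) :
    spreadLeaf I n y → oddLeaf I n y :=
  fun h => Or.inl (spreadLeaf_le_deepLeaf I n y h)

/-- `cylLeaf_le_oddLeaf`: Auxiliary step of this node's calculus, VERBATIM from the lens file (see the module
docstring); the statement is its type. [folklore] -/
theorem cylLeaf_le_oddLeaf ⦃Y : Scheme.{0}⦄ (I : Y.IdealSheafData) (n : ℕ) (y : Y) :
    cylLeaf I n y → oddLeaf I n y :=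
  fun h => Or.inl (cylLeaf_le_deepLeaf I n y h)

/-- `splitLeaf_le_oddLeaf`: Auxiliary step of this node's calculus, VERBATIM from the lens file (see the module
docstring); the statement is its type. [folklore] -/
theorem splitLeaf_le_oddLeaf ⦃Y : Scheme.{0}⦄ (I : Y.IdealSheafData) (n : ℕ) (y : Y) :
    splitLeaf I n y → oddLeaf I n y :=
  fun h => Or.inl (splitLeaf_le_deepLeaf I n y h)

/-- `grandLeaf_le_oddLeaf`: Auxiliary step of this node's calculus, VERBATIM from the lens file (see the module
docstring); the statement is its type. [folklore] -/
theorem grandLeaf_le_oddLeaf ⦃Y : Scheme.{0}⦄ (I : Y.IdealSheafData) (n : ℕ) (y : Y) :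
    grandLeaf I n y → oddLeaf I n y :=
  fun h => Or.inl (grandLeaf_le_deepLeaf I n y h)

/-- `vastLeaf_le_oddLeaf`: Auxiliary step of this node's calculus, VERBATIM from the lens file (see the module
docstring); the statement is its type. [folklore] -/
theorem vastLeaf_le_oddLeaf ⦃Y : Scheme.{0}⦄ (I : Y.IdealSheafData) (n : ℕ) (y : Y) :
    vastLeaf I n y → oddLeaf I n y :=
  fun h => Or.inl (vastLeaf_le_deepLeaf I n y h)

/-- `pinchLeaf_le_oddLeaf`: Auxiliary step of this node's calculus, VERBATIM from the lens file (see the module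
docstring); the statement is its type. [folklore] -/
theorem pinchLeaf_le_oddLeaf ⦃Y : Scheme.{0}⦄ (I : Y.IdealSheafData) (n : ℕ) (y : Y) :
    pinchLeaf I n y → oddLeaf I n y :=
  fun h => Or.inl (pinchLeaf_le_deepLeaf I n y h)

/-- `oddLeaf_of_isOddCrossPt`: Auxiliary step of this node's calculus, VERBATIM from the lens file (see the module
docstring); the statement is its type. [folklore] -/
theorem oddLeaf_of_isOddCrossPt ⦃Y : Scheme.{0}⦄ {I : Y.IdealSheafData} {n : ℕ} {y : Y}
    (h : IsOddCrossPt I n y) : oddLeaf I n y :=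
  Or.inr h

/-- `oddLeaf_of_isDeepCrossPt`: Auxiliary step of this node's calculus, VERBATIM from the lens file (see the module
docstring); the statement is its type. [folklore] -/
theorem oddLeaf_of_isDeepCrossPt ⦃Y : Scheme.{0}⦄ {I : Y.IdealSheafData} {n : ℕ} {y : Y}
    (h : IsDeepCrossPt I n y) : oddLeaf I n y :=
  Or.inl (deepLeaf_of_isDeepCrossPt h)

/-- `oddLeaf_of_isNodePt`: Auxiliary step of this node's calculus, VERBATIM from the lens file (see the module
docstring); the statement is its type. [folklore] -/
theorem oddLeaf_of_isNodePt ⦃Y : Scheme.{0}⦄ {I : Y.IdealSheafData} {n : ℕ} {y : Y}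
    (h : IsNodePt I n y) : oddLeaf I n y :=
  Or.inl (deepLeaf_of_isNodePt h)

/-- **ODD-SPECIAL point** [g23] — THE LOCATED RESIDUAL CLASS of this node: deep-special (g22) and NOT an odd-cross
point.  What is LEFT
(booked, NODE-g23 §7): cuspidal secondary curves (INSEP-v³, E**), crosses / nodes at marking `n ≥ 3`, EVEN flat
depths, tangential or singular
branches at the tangle, three or more branches, top surfaces through the core, `m ≢ −1 (mod n)`, mixed faces,
NON-PRINCIPAL `I_y` beyond the
letters, Sing / Iso, AND (new, by the odd guard) deep crosses in odd residue characteristic `p` with `p ∣ m`, `p ∣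
d` (inhabitation not
certified; candidate `z² + (1+t)x³ + t²y⁹ + λx²y⁴t /𝔽₃`, §Z.1 GUARD).  DEFINITION (NEW class). [folklore] -/
def IsOddSpecialPt {k : Type} [Field k] {Y : Scheme.{0}} (g : Y ⟶ Spec (.of k)) (hY : Scheme.IsRegular Y)
    (I : Y.IdealSheafData) (n : ℕ) (y : Y) : Prop :=
  IsDeepSpecialPt g hY I n y ∧ ¬ IsOddCrossPt I n y

/-- Pointwise: the odd-special class IS the `oddLeaf`-special class of §G.  KERNEL (PROVED). [folklore] -/
theorem isSpecPt_oddLeaf_iff {k : Type} [Field k] {Y : Scheme.{0}} (g : Y ⟶ Spec (.of k)) (hY : Scheme.IsRegular Y)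
    (I : Y.IdealSheafData) (n : ℕ) (y : Y) : Leaf.IsSpecPt oddLeaf g hY I n y ↔ IsOddSpecialPt g hY I n y := by
  constructor
  · rintro ⟨hL, hno⟩
    exact ⟨(isSpecPt_deepLeaf_iff g hY I n y).mp ⟨hL, fun h => hno (Or.inl h)⟩, fun h => hno (Or.inr h)⟩
  · rintro ⟨hS, hO⟩
    obtain ⟨hL, hno⟩ := (isSpecPt_deepLeaf_iff g hY I n y).mpr hS
    refine ⟨hL, ?_⟩
    rintro (h | h)
    · exact hno h
    · exact hO h

/-- The odd-special class is contained in g22's deep-special class (the residual SHRINKS by letter).  KERNEL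
(PROVED). [folklore] -/
theorem isDeepSpecialPt_of_isOddSpecialPt {k : Type} [Field k] {Y : Scheme.{0}} {g : Y ⟶ Spec (.of k)}
    {hY : Scheme.IsRegular Y} {I : Y.IdealSheafData} {n : ℕ} {y : Y} (h : IsOddSpecialPt g hY I n y) :
    IsDeepSpecialPt g hY I n y :=
  h.1

/-- … and hence in g20's cross-special class.  KERNEL (PROVED). [folklore] -/
theorem isCrossSpecialPt_of_isOddSpecialPt {k : Type} [Field k] {Y : Scheme.{0}} {g : Y ⟶ Spec (.of k)}
    {hY : Scheme.IsRegular Y} {I : Y.IdealSheafData} {n : ℕ} {y : Y} (h : IsOddSpecialPt g hY I n y) :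
    IsCrossSpecialPt g hY I n y :=
  h.1.1

/-- **EXACT POINTWISE DICHOTOMY of g22's residual class** (the structural dichotomy at a point, g23): deep-special ⟺
(deep-special and an
odd-cross point — engine side (X***)) ∨ odd-special.  KERNEL (PROVED). [folklore] -/
theorem isDeepSpecialPt_iff {k : Type} [Field k] {Y : Scheme.{0}} (g : Y ⟶ Spec (.of k)) (hY : Scheme.IsRegular Y)
    (I : Y.IdealSheafData) (n : ℕ) (y : Y) :
    IsDeepSpecialPt g hY I n y ↔
      (IsDeepSpecialPt g hY I n y ∧ IsOddCrossPt I n y) ∨ IsOddSpecialPt g hY I n y := by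
  constructor
  · intro h
    by_cases ho : IsOddCrossPt I n y
    · exact Or.inl ⟨h, ho⟩
    · exact Or.inr ⟨h, ho⟩
  · rintro (⟨h, _⟩ | ⟨h, _⟩) <;> exact h

/-- At markings `n ≠ 2` the odd-special class IS the deep-special class (the new letter is a marking-`2` letter).
KERNEL (PROVED). [folklore] -/
theorem isOddSpecialPt_iff_of_ne_two {k : Type} [Field k] {Y : Scheme.{0}} (g : Y ⟶ Spec (.of k)) (hY : Scheme.IsRegular Y)
    (I : Y.IdealSheafData) {n : ℕ} (hn : n ≠ 2) (y : Y) :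
    IsOddSpecialPt g hY I n y ↔ IsDeepSpecialPt g hY I n y :=
  ⟨fun h => h.1, fun h => ⟨h, fun hc => hn (eq_two_of_isOddCrossPt hc)⟩⟩

/-- In residue characteristic `2` the odd-special class IS the deep-special class (the odd letter asks residue
characteristic `≠ 2`).  KERNEL
(PROVED). [folklore] -/
theorem isOddSpecialPt_iff_of_ringChar_eq_two {k : Type} [Field k] {Y : Scheme.{0}} (g : Y ⟶ Spec (.of k))
    (hY : Scheme.IsRegular Y) (I : Y.IdealSheafData) (n : ℕ) (y : Y)
    (h2 : ringChar (ResidueField (Y.presheaf.stalk y)) = 2) :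
    IsOddSpecialPt g hY I n y ↔ IsDeepSpecialPt g hY I n y :=
  ⟨fun h => h.1, fun h => ⟨h, fun hc => ringChar_ne_two_of_isOddCrossPt hc h2⟩⟩

namespace OddX

/-! ### §Z.5  The graded statements of the ODD cut (instances of §G with the odd leaf) -/

/-- **`SeqOddGen n`** — weak order reduction in dimension four at marking `n` for data ALL of whose top points are
in the decided classes
of g22 or ODD-CROSS points.  [DECIDED-MOD-PORT and MOD-(X**)(X***): `oddGenRungAt_of_engines`.]  STATEMENT SCHEMA (=
`Leaf.SeqGen oddLeaf n`). (Sources: BierstoneGrigorievMilmanWlodarczyk2011 §3.1; CossartPiltant2008 Prop. 4.2; Hironaka1967.) -/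
def SeqOddGen (n : ℕ) : Prop := Leaf.SeqGen oddLeaf n

/-- **`SeqOddSpec n`** — THE LOCATED CLASS: weak order reduction at marking `n` for data having an ODD-SPECIAL core top point.
[UNDECIDED · IDEA-NEEDED.]  STATEMENT SCHEMA (= `Leaf.SeqSpec oddLeaf n`). (Sources: CossartPiltant2019 Rem. 3.2; Moh1987.) -/
def SeqOddSpec (n : ℕ) : Prop := Leaf.SeqSpec oddLeaf n

/-- `OddGenRungAt n` — the decided rung at one marking. -/
def OddGenRungAt (n : ℕ) : Prop := SeqDimFour 2 n → SeqOddGen n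

/-- **`OddGenericRung`** — the DECIDED-MOD-ENGINES half of `RungOne` (29273) for the odd leaf.  [WEAKER ·
DECIDED-MOD-PORT(M+)·MOD-(X**)(X***):
`oddGenericRung_of_ports`.]  STATEMENT (decided piece). (Sources: Hironaka1967; CossartPiltant2008 Prop. 4.2;
CossartJannsenSaito2020.) -/
def OddGenericRung : Prop := E 2 → ∀ n : ℕ, 1 ≤ n → SeqOddGen n

/-- **`OddSpecialRung`** — THE LOCATED RESIDUAL of this node: `E 2 →` weak order reduction for every marking and all
data with an
odd-special core top point.  [WEAKER BY LETTER than `Deep.DeepSpecialRung` · UNDECIDED · IDEA-NEEDED · cofinal ⇒ score 0.]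
STATEMENT (located residual). (Sources: CossartPiltant2019 Rem. 3.2; Moh1987; Giraud1975; Narasimhan1983.) -/
def OddSpecialRung : Prop := E 2 → ∀ n : ℕ, 1 ≤ n → SeqOddSpec n

/-- `oddGenericRung_iff`: Auxiliary step of this node's calculus, VERBATIM from the lens file (see the module
docstring); the statement is its type. [folklore] -/
theorem oddGenericRung_iff : OddGenericRung ↔ Leaf.GenericRung oddLeaf := Iff.rfl

/-- `oddSpecialRung_iff`: Auxiliary step of this node's calculus, VERBATIM from the lens file (see the module
docstring); the statement is its type. [folklore] -/
theorem oddSpecialRung_iff : OddSpecialRung ↔ Leaf.SpecialRung oddLeaf := Iff.rfl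

section Kernels

variable {n : ℕ}

/-! ### §Z.6  Kernels of the ODD cut (instantiated from §G; 0 sorry) -/

/-- **EXACT at each marking**: `SeqDimFour 1 n ⟺ SeqOddGen n ∧ SeqOddSpec n`. [folklore] -/
theorem seqDimFour_one_iff : SeqDimFour 1 n ↔ SeqOddGen n ∧ SeqOddSpec n :=
  Leaf.seqDimFour_one_iff (L := oddLeaf)

/-- Under the engines (M) (C) (G) (S) (Cyl) (JCyl) (Γ) (X) (X**) (N) and the NEW (X***) every point of the odd leaf
is a curve-exit point
or a component-exit point. [folklore] -/
theorem isExitPt_of_oddLeaf (hM : MonomialPinchExit) (hC : FlatConeExit) (hGE : GrandExit) (hSE : SplitConeExit)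
    (hCE : CylinderExit) (hJE : JetCylinderExit) (hΓE : SpreadExit) (hXE : CrossExit) (hDXE : DeepCrossExit) (hNE : NodeExit)
    (hOXE : OddCrossExit)
    (hn : 2 ≤ n) ⦃Y : Scheme.{0}⦄ (hY : Scheme.IsRegular Y) ⦃I : Y.IdealSheafData⦄ ⦃y : Y⦄ (h : oddLeaf I n y) :
    IsCurveExitPt I n y ∨ IsComponentExitPt I n y := by
  rcases h with h | h
  · exact Deep.isExitPt_of_deepLeaf hM hC hGE hSE hCE hJE hΓE hXE hDXE hNE hn hY h
  · exact Or.inr (isComponentExitPt_of_isOddCrossPt hOXE hY h)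

/-- **THE ENGINES AT WORK**: the five tree engines, (M) (C) (G) (S) (Cyl) (JCyl) (Γ) (X) (X**) (N), the NEW (X***)
and the COMPONENT port
give `OddGenRungAt n` for `n ≥ 2`. [folklore] -/
theorem oddGenRungAt_of_engines (hV : VeryNearCutClasses.VeryNearExit) (hD : DeltaPackageExit)
    (hU : UniformCurvePackageExit) (hR : RelCurvePackageExit) (hN : NormalConeJumpExit)
    (hM : MonomialPinchExit) (hC : FlatConeExit) (hGE : GrandExit) (hSE : SplitConeExit)
    (hCE : CylinderExit) (hJE : JetCylinderExit) (hΓE : SpreadExit) (hXE : CrossExit) (hDXE : DeepCrossExit) (hNE : NodeExit)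
    (hOXE : OddCrossExit)
    (hP : ComponentPackagePort n) (hn : 2 ≤ n) : OddGenRungAt n :=
  Leaf.genRungAt_of_componentPort (L := oddLeaf) hV hD hU hR hN
    (isExitPt_of_oddLeaf hM hC hGE hSE hCE hJE hΓE hXE hDXE hNE hOXE hn) hP hn

/-- **`OddGenericRung` is DECIDED modulo the typed pieces**: engines (as hypotheses; (X**) and (X***) among them
DECIDED on paper, kernel
ports open), the component port at every marking `≥ 2`, the order-one contact port. [folklore] -/
theorem oddGenericRung_of_engines (hV : VeryNearCutClasses.VeryNearExit) (hD : DeltaPackageExit)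
    (hU : UniformCurvePackageExit) (hR : RelCurvePackageExit) (hN : NormalConeJumpExit)
    (hM : MonomialPinchExit) (hC : FlatConeExit) (hGE : GrandExit) (hSE : SplitConeExit)
    (hCE : CylinderExit) (hJE : JetCylinderExit) (hΓE : SpreadExit) (hXE : CrossExit) (hDXE : DeepCrossExit) (hNE : NodeExit)
    (hOXE : OddCrossExit)
    (hP : ∀ n : ℕ, 2 ≤ n → ComponentPackagePort n) (h1 : FaceFormCutClasses.OrderOneContact) : OddGenericRung :=
  Leaf.genericRung_of_componentPort (L := oddLeaf) hV hD hU hR hN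
    (fun _ hn => isExitPt_of_oddLeaf hM hC hGE hSE hCE hJE hΓE hXE hDXE hNE hOXE hn) hP h1

/-! ### §Z.7  EXACT RE-LOCATIONS (the residual shrinks; equivalent modulo the odd decided half) -/

/-- **REFINEMENT EDGE (hypothesis-free)**: g22's residual implies g23's — `Deep.DeepSpecialRung → OddSpecialRung`
(WEAKER BY LETTER).
[folklore] -/
theorem oddSpecialRung_of_deepSpecialRung (h : Deep.DeepSpecialRung) : OddSpecialRung :=
  Leaf.specialRung_mono deepLeaf_le_oddLeaf (Deep.deepSpecialRung_iff.mp h)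

/-- The odd decided half contains g22's: `OddGenericRung → Deep.DeepGenericRung`. [folklore] -/
theorem deepGenericRung_of_oddGenericRung (h : OddGenericRung) : Deep.DeepGenericRung :=
  Deep.deepGenericRung_iff.mpr (Leaf.genericRung_anti deepLeaf_le_oddLeaf h)

end Kernels

end OddX

end Summit.ResolutionOfSingularities.ResolutionOfSingularities.Theorems.OddCrossCut
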